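import Summits.Ventures.LatticeQCDFlow.Exactness.Phi4HMCLeapfrogStages
import HarnessLib

/-!
# The leapfrog overshoots the quartic wall, IV: the stage levels grow like `t^{3^k}`

HONEST FRAMING: exact (Metropolis-corrected) sampling algorithms for lattice gauge theory;
figures of merit are autocorrelation/cost numbers at stated couplings and volumes; no
continuum-physics claim.  (SCALAR calibration rung S0-A: not a gauge result.)

Venture `LatticeQCDFlow` (cell pub-lqcd), topic `Exactness`; FANOUT row 2 (`s0-phi4`, HMC arm).
NEW WORK of the cell (elementary real inequalities) over the level map `Φ` of
`Exactness/Phi4HMCLeapfrogStages.lean`.  Nothing is cited as a fact.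

## What is proved (`λ, δ > 0`, `C ≥ 0` standing for `C_J`)

* `pow_dominate`, `level_step_a`, `level_step_b`, `level_step_B` — one application of `Φ` to levels of
  sizes `(t^e, t^e, t^{3e}, t^{3e})` produces levels of sizes `(t^{3e}, t^{3e}, t^{9e}, t^{9e})`, with
  explicit constants, for `t` beyond explicit thresholds;
* **`levels_growth`** — from stage zero `v₀(t) = (t/2, 5t/2, δλt³/4, t/δ + δ(4λ(5t/2)³ + 5Ct))`, for
  every `k` there are `T ≥ 1`, `c_a, c_b > 0`, `C_A, C_B ≥ 0` with, for all `t ≥ T`: the intermediate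
  levels admissible (`a_j, b_j, δb_j − A_j ≥ 0`, `j < k`) and `c_a t^{3^k} ≤ a_k`, `A_k ≤ C_A t^{3^k}`,
  `c_b t^{3^{k+1}} ≤ b_k`, `0 ≤ B_k ≤ C_B t^{3^{k+1}}`.

Used by `Exactness/Phi4HMCTailRejectionN.lean`.  NOT CLAIMED: sharp constants.
-/

namespace Summit.Ventures.LatticeQCDFlow.Exactness

open Real MeasureTheory Filter Finset
open Summit.Ventures.LatticeQCDFlow.Scoring

section Levels

/-! ## §1 Growth of the levels along the iteration -/

/-- Elementary domination: `t ≥ 1`, `i < j`, `α > 0`, `2β ≤ α t` ⇒ `β t^i ≤ (α/2) t^j`. -/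
theorem pow_dominate {α β t : ℝ} {i j : ℕ} (hα : 0 < α) (ht : 1 ≤ t) (hij : i < j)
    (hbig : 2 * β ≤ α * t) : β * t ^ i ≤ α / 2 * t ^ j := by
  have hti : 0 ≤ t ^ i := by positivity
  have h1 : t ^ (i + 1) ≤ t ^ j := pow_le_pow_right₀ ht hij
  have h2 : β * t ^ i ≤ α / 2 * t ^ (i + 1) := by
    rw [pow_succ]
    nlinarith
  have h3 : α / 2 * t ^ (i + 1) ≤ α / 2 * t ^ j := mul_le_mul_of_nonneg_left h1 (by positivity)
  linarith

/-- Level step (a): `a' = δb − A ≥ (δc_b/2) t^{3e}`. -/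
theorem level_step_a {δ cb CA A b t : ℝ} {e : ℕ} (hδ : 0 < δ) (hcb : 0 < cb) (ht : 1 ≤ t)
    (he : 1 ≤ e) (hb : cb * t ^ (3 * e) ≤ b) (hA : A ≤ CA * t ^ e) (hthr : 2 * CA ≤ δ * cb * t) :
    δ * cb / 2 * t ^ (3 * e) ≤ δ * b - A := by
  have hdom : CA * t ^ e ≤ δ * cb / 2 * t ^ (3 * e) :=
    pow_dominate (by positivity) ht (by omega) hthr
  have h1 : δ * (cb * t ^ (3 * e)) ≤ δ * b := mul_le_mul_of_nonneg_left hb hδ.le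
  linarith

/-- Level step (b): with `a' ≥ c t^{3e}` (`c > 0`) and `B ≤ C_B t^{3e}`:
`δ(4λa'³ − 2C δB) − B ≥ (2δλc³) t^{9e}` once `2(2Cδ²C_B + C_B) ≤ 2δλc³ · t`. -/
theorem level_step_b {lam δ C c CB a' B t : ℝ} {e : ℕ} (hlam : 0 < lam) (hδ : 0 < δ) (hC : 0 ≤ C)
    (hc : 0 < c) (ht : 1 ≤ t) (he : 1 ≤ e) (ha' : c * t ^ (3 * e) ≤ a') (hB : B ≤ CB * t ^ (3 * e))
    (hthr : 2 * (2 * C * δ ^ 2 * CB + CB) ≤ 2 * δ * lam * c ^ 3 * t) :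
    2 * δ * lam * c ^ 3 * t ^ (9 * e) ≤ δ * (4 * lam * a' ^ 3 - 2 * C * (δ * B)) - B := by
  have hcube : (c * t ^ (3 * e)) ^ 3 ≤ a' ^ 3 := pow_le_pow_left₀ (by positivity) ha' 3
  have e9 : (c * t ^ (3 * e)) ^ 3 = c ^ 3 * t ^ (9 * e) := by
    rw [mul_pow, ← pow_mul]; congr 1; ring_nf
  rw [e9] at hcube
  have hdom : (2 * C * δ ^ 2 * CB + CB) * t ^ (3 * e) ≤ (2 * δ * lam * c ^ 3) / 2 * t ^ (9 * e) :=
    pow_dominate (by positivity) ht (by omega) hthr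
  have h1 : δ * (4 * lam * (c ^ 3 * t ^ (9 * e))) ≤ δ * (4 * lam * a' ^ 3) :=
    mul_le_mul_of_nonneg_left (mul_le_mul_of_nonneg_left hcube (by positivity)) hδ.le
  have h2 : δ * (2 * C * (δ * B)) + B ≤ (2 * C * δ ^ 2 * CB + CB) * t ^ (3 * e) := by
    have hC2 : 0 ≤ 2 * C * δ ^ 2 := by positivity
    nlinarith [mul_le_mul_of_nonneg_left hB hC2]
  have h0 : 0 ≤ δ * lam * c ^ 3 * t ^ (9 * e) := by positivity
  have e1 : δ * (4 * lam * (c ^ 3 * t ^ (9 * e))) = 4 * (δ * lam * c ^ 3 * t ^ (9 * e)) := by ring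
  have e2 : (2 * δ * lam * c ^ 3) / 2 * t ^ (9 * e) = δ * lam * c ^ 3 * t ^ (9 * e) := by ring
  have e3 : δ * (4 * lam * a' ^ 3 - 2 * C * (δ * B)) - B
      = δ * (4 * lam * a' ^ 3) - (δ * (2 * C * (δ * B)) + B) := by ring
  rw [e1] at h1
  rw [e2] at hdom
  rw [e3]
  have e4 : 2 * δ * lam * c ^ 3 * t ^ (9 * e) = 2 * (δ * lam * c ^ 3 * t ^ (9 * e)) := by ring
  rw [e4]
  linarith

/-- Level step (B): `B ≥ 0`, `B ≤ C_B t^{3e}`, `t ≥ 1` ⇒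
`δ(4λ(δB)³ + 2CδB) + B ≤ (4λδ⁴C_B³ + 2Cδ²C_B + C_B) t^{9e}`. -/
theorem level_step_B {lam δ C CB B t : ℝ} {e : ℕ} (hlam : 0 < lam) (hδ : 0 < δ) (hC : 0 ≤ C)
    (hCB : 0 ≤ CB) (ht : 1 ≤ t) (hB0 : 0 ≤ B) (hB : B ≤ CB * t ^ (3 * e)) :
    δ * (4 * lam * (δ * B) ^ 3 + 2 * C * (δ * B)) + B
      ≤ (4 * lam * δ ^ 4 * CB ^ 3 + 2 * C * δ ^ 2 * CB + CB) * t ^ (9 * e) := by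
  have htp : t ^ (3 * e) ≤ t ^ (9 * e) := pow_le_pow_right₀ ht (by omega)
  have hBt : B ≤ CB * t ^ (9 * e) := le_trans hB (mul_le_mul_of_nonneg_left htp hCB)
  have hcube : (δ * B) ^ 3 ≤ (δ * (CB * t ^ (3 * e))) ^ 3 :=
    pow_le_pow_left₀ (by positivity) (mul_le_mul_of_nonneg_left hB hδ.le) 3
  have e1 : (δ * (CB * t ^ (3 * e))) ^ 3 = δ ^ 3 * CB ^ 3 * t ^ (9 * e) := by
    rw [mul_pow, mul_pow, ← pow_mul]; ring_nf
  rw [e1] at hcube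
  have hC2 : 0 ≤ 2 * C * δ ^ 2 := by positivity
  nlinarith [mul_le_mul_of_nonneg_left hcube (by positivity : (0 : ℝ) ≤ δ * (4 * lam)),
    mul_le_mul_of_nonneg_left hBt hC2]

/-- **GROWTH OF THE LEVELS.**  From stage zero `v₀(t) = (t/2, 5t/2, δλt³/4, t/δ + δ(4λ(5t/2)³ + 5Ct))`
along the level map `Φ` (`C = C_J`), for every `k`: there are `T ≥ 1` and constants `c_a, c_b > 0`,
`C_A, C_B ≥ 0` such that for all `t ≥ T` the intermediate levels are admissible
(`a_j, b_j, δb_j − A_j ≥ 0` for `j < k`) and `c_a t^{3^k} ≤ a_k`, `A_k ≤ C_A t^{3^k}`,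
`c_b t^{3^{k+1}} ≤ b_k`, `0 ≤ B_k ≤ C_B t^{3^{k+1}}`. -/
theorem levels_growth {lam δ : ℝ} (hlam : 0 < lam) (hδ : 0 < δ) (C : ℝ) (hC : 0 ≤ C)
    (Φ : ℝ × ℝ × ℝ × ℝ → ℝ × ℝ × ℝ × ℝ)
    (hΦ : Φ = fun w => (δ * w.2.2.1 - w.2.1, δ * w.2.2.2,
      δ * (4 * lam * (δ * w.2.2.1 - w.2.1) ^ 3 - 2 * C * (δ * w.2.2.2)) - w.2.2.2,
      δ * (4 * lam * (δ * w.2.2.2) ^ 3 + 2 * C * (δ * w.2.2.2)) + w.2.2.2)) (k : ℕ) :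
    ∃ T ca CA cb CB : ℝ, 1 ≤ T ∧ 0 < ca ∧ 0 ≤ CA ∧ 0 < cb ∧ 0 ≤ CB ∧ ∀ t : ℝ, T ≤ t →
      (∀ j, j < k →
        0 ≤ (Φ^[j] (t / 2, 5 * t / 2, δ * lam * t ^ 3 / 4,
          t / δ + δ * (4 * lam * (5 * t / 2) ^ 3 + 2 * C * (5 * t / 2)))).1 ∧
        0 ≤ (Φ^[j] (t / 2, 5 * t / 2, δ * lam * t ^ 3 / 4,
          t / δ + δ * (4 * lam * (5 * t / 2) ^ 3 + 2 * C * (5 * t / 2)))).2.2.1 ∧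
        0 ≤ δ * (Φ^[j] (t / 2, 5 * t / 2, δ * lam * t ^ 3 / 4,
          t / δ + δ * (4 * lam * (5 * t / 2) ^ 3 + 2 * C * (5 * t / 2)))).2.2.1
          - (Φ^[j] (t / 2, 5 * t / 2, δ * lam * t ^ 3 / 4,
          t / δ + δ * (4 * lam * (5 * t / 2) ^ 3 + 2 * C * (5 * t / 2)))).2.1) ∧
      ca * t ^ (3 ^ k) ≤ (Φ^[k] (t / 2, 5 * t / 2, δ * lam * t ^ 3 / 4,
          t / δ + δ * (4 * lam * (5 * t / 2) ^ 3 + 2 * C * (5 * t / 2)))).1 ∧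
      (Φ^[k] (t / 2, 5 * t / 2, δ * lam * t ^ 3 / 4,
          t / δ + δ * (4 * lam * (5 * t / 2) ^ 3 + 2 * C * (5 * t / 2)))).2.1 ≤ CA * t ^ (3 ^ k) ∧
      cb * t ^ (3 ^ (k + 1)) ≤ (Φ^[k] (t / 2, 5 * t / 2, δ * lam * t ^ 3 / 4,
          t / δ + δ * (4 * lam * (5 * t / 2) ^ 3 + 2 * C * (5 * t / 2)))).2.2.1 ∧
      0 ≤ (Φ^[k] (t / 2, 5 * t / 2, δ * lam * t ^ 3 / 4,
          t / δ + δ * (4 * lam * (5 * t / 2) ^ 3 + 2 * C * (5 * t / 2)))).2.2.2 ∧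
      (Φ^[k] (t / 2, 5 * t / 2, δ * lam * t ^ 3 / 4,
          t / δ + δ * (4 * lam * (5 * t / 2) ^ 3 + 2 * C * (5 * t / 2)))).2.2.2
        ≤ CB * t ^ (3 ^ (k + 1)) := by
  induction k with
  | zero =>
    refine ⟨1, 1 / 2, 5 / 2, δ * lam / 4, 1 / δ + δ * (4 * lam * (5 / 2) ^ 3 + 2 * C * (5 / 2)),
      le_rfl, by norm_num, by norm_num, by positivity, by positivity, fun t ht => ?_⟩
    have ht0 : 0 ≤ t := by linarith
    have ht3 : t ≤ t ^ 3 := le_self_pow₀ ht (by norm_num)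
    simp only [Function.iterate_zero, id_eq, pow_zero, pow_one, zero_add]
    refine ⟨fun j hj => absurd hj (Nat.not_lt_zero j), by linarith, by linarith, le_of_eq (by ring),
      by positivity, ?_⟩
    have h1 : t / δ ≤ 1 / δ * t ^ 3 := by
      rw [div_eq_mul_one_div, mul_comm]
      exact mul_le_mul_of_nonneg_left ht3 (by positivity)
    have h2 : δ * (2 * C * (5 * t / 2)) ≤ δ * (2 * C * (5 / 2)) * t ^ 3 := by
      have : δ * (2 * C * (5 * t / 2)) = δ * (2 * C * (5 / 2)) * t := by ring
      rw [this]
      exact mul_le_mul_of_nonneg_left ht3 (by positivity)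
    have e : δ * (4 * lam * (5 * t / 2) ^ 3) = δ * (4 * lam * (5 / 2) ^ 3) * t ^ 3 := by ring
    nlinarith [e, h1, h2]
  | succ k ih =>
    obtain ⟨T, ca, CA, cb, CB, hT, hca, hCA, hcb, hCB, hk⟩ := ih
    refine ⟨max T (2 * CA / (δ * cb) + 2 * (2 * C * δ ^ 2 * CB + CB) / (2 * δ * lam * (δ * cb / 2) ^ 3) + 1),
      δ * cb / 2, δ * CB, 2 * δ * lam * (δ * cb / 2) ^ 3, 4 * lam * δ ^ 4 * CB ^ 3 + 2 * C * δ ^ 2 * CB + CB,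
      le_trans hT (le_max_left _ _), by positivity, by positivity, by positivity, by positivity,
      fun t ht => ?_⟩
    have htT : T ≤ t := le_trans (le_max_left _ _) ht
    have ht1 : 1 ≤ t := le_trans hT htT
    obtain ⟨hpos, ha, hA, hb, hB0, hB⟩ := hk t htT
    set v₀ : ℝ × ℝ × ℝ × ℝ := (t / 2, 5 * t / 2, δ * lam * t ^ 3 / 4,
      t / δ + δ * (4 * lam * (5 * t / 2) ^ 3 + 2 * C * (5 * t / 2))) with hv₀
    set w := Φ^[k] v₀ with hw
    have hsucc : Φ^[k + 1] v₀ = (δ * w.2.2.1 - w.2.1, δ * w.2.2.2,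
        δ * (4 * lam * (δ * w.2.2.1 - w.2.1) ^ 3 - 2 * C * (δ * w.2.2.2)) - w.2.2.2,
        δ * (4 * lam * (δ * w.2.2.2) ^ 3 + 2 * C * (δ * w.2.2.2)) + w.2.2.2) := by
      rw [Function.iterate_succ_apply', ← hw, hΦ]
    -- thresholds
    have hthr : 2 * CA / (δ * cb) + 2 * (2 * C * δ ^ 2 * CB + CB) / (2 * δ * lam * (δ * cb / 2) ^ 3) + 1
        ≤ t := le_trans (le_max_right _ _) ht
    have hq1 : 0 ≤ 2 * CA / (δ * cb) := by positivity
    have hq2 : 0 ≤ 2 * (2 * C * δ ^ 2 * CB + CB) / (2 * δ * lam * (δ * cb / 2) ^ 3) := by positivity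
    have hthr1 : 2 * CA ≤ δ * cb * t := by
      have h1 : 2 * CA / (δ * cb) ≤ t := by linarith
      have h2 := (div_le_iff₀ (by positivity : (0 : ℝ) < δ * cb)).mp h1
      linarith [mul_comm t (δ * cb)]
    have hthr2 : 2 * (2 * C * δ ^ 2 * CB + CB) ≤ 2 * δ * lam * (δ * cb / 2) ^ 3 * t := by
      have h1 : 2 * (2 * C * δ ^ 2 * CB + CB) / (2 * δ * lam * (δ * cb / 2) ^ 3) ≤ t := by linarith
      have h2 := (div_le_iff₀ (by positivity : (0 : ℝ) < 2 * δ * lam * (δ * cb / 2) ^ 3)).mp h1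
      linarith [mul_comm t (2 * δ * lam * (δ * cb / 2) ^ 3)]
    -- exponents `3^(k+1) = 3·3^k`, `3^(k+2) = 9·3^k`
    have he : 1 ≤ 3 ^ k := Nat.one_le_pow _ _ (by norm_num)
    have e3 : 3 ^ (k + 1) = 3 * 3 ^ k := by rw [pow_succ]; ring
    have e9 : 3 ^ (k + 1 + 1) = 9 * 3 ^ k := by rw [pow_succ, pow_succ]; ring
    rw [e3] at hb hB
    have ha' := level_step_a (e := 3 ^ k) hδ hcb ht1 he hb hA hthr1
    have hA' : δ * w.2.2.2 ≤ δ * CB * t ^ (3 * 3 ^ k) := by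
      nlinarith [mul_le_mul_of_nonneg_left hB hδ.le]
    have hb' := level_step_b (e := 3 ^ k) hlam hδ hC (by positivity : 0 < δ * cb / 2) ht1 he ha' hB hthr2
    have hB' := level_step_B (e := 3 ^ k) hlam hδ hC hCB ht1 hB0 hB
    have hB'0 : 0 ≤ δ * (4 * lam * (δ * w.2.2.2) ^ 3 + 2 * C * (δ * w.2.2.2)) + w.2.2.2 := by positivity
    refine ⟨fun j hj => ?_, ?_, ?_, ?_, ?_, ?_⟩
    · rcases Nat.lt_succ_iff_lt_or_eq.mp hj with hj' | hj'
      · exact hpos j hj'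
      · rw [hj']
        exact ⟨le_trans (by positivity) ha, le_trans (by positivity) hb, le_trans (by positivity) ha'⟩
    · rw [hsucc, e3]; exact ha'
    · rw [hsucc, e3]; exact hA'
    · rw [hsucc, e9]; exact hb'
    · rw [hsucc]; exact hB'0
    · rw [hsucc, e9]; exact hB'

end Levels

end Summit.Ventures.LatticeQCDFlow.Exactness
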